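import Literature.MathematicalPhysics.QuantumLattice.HubbardScaleZeroSectorSymbolTime
import HarnessLib

/-!
# The radial factor of the scale-`0` sector multiplier along a path in the band variable: explicit first and second derivative bounds

Topic `MathematicalPhysics/QuantumLattice`; continuation of `HubbardScaleZeroSectorSymbolTime` (piece (C) of the symbol layer of the sector-function
`L¹` size `b₀`: the padded multiplier `bgmGridSymbol`, its sup, support and TIME second differences).  For the SPACE directions the padded
symbol along a lattice line `q⃗ + m e_l` is the product of the RADIAL factor `R(t) = H₀(√(ω̃² + e_K(p + t e_l)²))` — the cutoff in the band
variable composed with the frame band along the line (`ctLine`, with `|e′|, |e″| ≤ D` from `UVLineBound`, `HubbardUVSymbolCTDifferences`) — and the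
angular factor.  This file is the radial half, with explicit constants:

* `abs_cutoffFreqFnD1_le : |∂_x H₀(√(ν² + x²))| ≤ 8/(3e₀)` (the first band derivative; `|2xψ′(s)| ≤ |H₀′(√s)|` as `x² ≤ s`);
* `cutoffBandPathFn e₀ ν e t = H₀(√(ν² + e(t)²))`, `…D1/D2`, `hasDerivAt_cutoffBandPathFn(D1)` (chain rule through a `C²` path `e`);
* **`abs_cutoffBandPathFnD1_le`** (`≤ (8/(3e₀))·D`) and **`abs_cutoffBandPathFnD2_le`** (`≤ (448/(9e₀²))·D² + (8/(3e₀))·D`) under `|e′ t|, |e″ t| ≤ D`;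
* `abs_cutoffBandPathFn_le_one`.

Everything is proved; the three path functions are the only definitions; no named facts.

## Sources

G. Benfatto, A. Giuliani, V. Mastropietro, Ann. Henri Poincaré 7 (2006) 809–898, §2.2 (2.9), §2.5 Lemma 2.2, (2.36aa)
[`BenfattoGiulianiMastropietro2006`]; J. Feldman, M. Salmhofer, E. Trubowitz, J. Stat. Phys. 84 (1996) 1209–1336, §1 (the band `E = e + K`
along lines) [`FeldmanSalmhoferTrubowitz1996`].
-/

noncomputable section

namespace Literature.MathematicalPhysics.QuantumLattice

open Set

section Radial

variable {e₀ : ℝ}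

/-- **The first band derivative of the cutoff is bounded by `8/(3e₀)`**: `|∂_x H₀(√(ν² + x²))| = |2x·ψ′(x² + ν²)| ≤ |H₀′(√s)|`
(`|x| ≤ √s`). [cite: BenfattoGiulianiMastropietro2006, §2.5 Lemma 2.2] -/
theorem abs_cutoffFreqFnD1_le (he : 0 < e₀) (ν x : ℝ) : |cutoffFreqFnD1 e₀ ν x| ≤ 8 / (3 * e₀) := by
  rw [cutoffFreqFnD1]
  set s := x ^ 2 + ν ^ 2 with hs
  rcases lt_or_ge s (e₀ ^ 2 / 16) with hlt | hge
  · rw [gnSqCutoffD1_eq_zero he hlt, zero_mul, abs_zero]; positivity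
  · have hs0 : 0 < s := lt_of_lt_of_le (by positivity) hge
    have hsq0 : 0 < Real.sqrt s := Real.sqrt_pos.2 hs0
    have hxs : |x| ≤ Real.sqrt s := by
      rw [← Real.sqrt_sq_eq_abs]
      exact Real.sqrt_le_sqrt (by rw [hs]; nlinarith)
    rw [gnSqCutoffD1, abs_mul, abs_div, abs_mul, abs_of_pos hsq0, abs_two, show |2 * x| = 2 * |x| by rw [abs_mul, abs_two]]
    calc |deriv (gnCutoff 4 e₀) (Real.sqrt s)| / (2 * Real.sqrt s) * (2 * |x|)
        = |deriv (gnCutoff 4 e₀) (Real.sqrt s)| * (|x| / Real.sqrt s) := by field_simp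
      _ ≤ |deriv (gnCutoff 4 e₀) (Real.sqrt s)| * 1 :=
          mul_le_mul_of_nonneg_left ((div_le_one hsq0).2 hxs) (abs_nonneg _)
      _ ≤ 8 / (3 * e₀) := by rw [mul_one]; exact abs_deriv_gnCutoff_four_le he _

/-- **The radial factor along a path in the band variable**: `R(t) = H₀(√(ν² + e(t)²))`. [cite: BenfattoGiulianiMastropietro2006, §2.5 (2.48)] -/
def cutoffBandPathFn (e₀ ν : ℝ) (e : ℝ → ℝ) (t : ℝ) : ℝ := cutoffFreqFn e₀ ν (e t)

/-- `R′ = (∂_x φ)(e)·e′`. [cite: BenfattoGiulianiMastropietro2006, §2.5 (2.48)] -/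
def cutoffBandPathFnD1 (e₀ ν : ℝ) (e e' : ℝ → ℝ) (t : ℝ) : ℝ := cutoffFreqFnD1 e₀ ν (e t) * e' t

/-- `R″ = (∂²_x φ)(e)·e′² + (∂_x φ)(e)·e″`. [cite: BenfattoGiulianiMastropietro2006, §2.5 (2.48)] -/
def cutoffBandPathFnD2 (e₀ ν : ℝ) (e e' e'' : ℝ → ℝ) (t : ℝ) : ℝ :=
  cutoffFreqFnD2 e₀ ν (e t) * e' t * e' t + cutoffFreqFnD1 e₀ ν (e t) * e'' t

/-- Chain rule: `R′ = cutoffBandPathFnD1`. [cite: BenfattoGiulianiMastropietro2006, §2.5 Lemma 2.2] -/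
theorem hasDerivAt_cutoffBandPathFn (he : 0 < e₀) (ν : ℝ) {e e' : ℝ → ℝ} {t : ℝ} (hd : HasDerivAt e (e' t) t) :
    HasDerivAt (cutoffBandPathFn e₀ ν e) (cutoffBandPathFnD1 e₀ ν e e' t) t :=
  (hasDerivAt_cutoffFreqFn he ν (e t)).comp t hd

/-- Chain and product rule: `(R′)′ = cutoffBandPathFnD2`. [cite: BenfattoGiulianiMastropietro2006, §2.5 Lemma 2.2] -/
theorem hasDerivAt_cutoffBandPathFnD1 (he : 0 < e₀) (ν : ℝ) {e e' e'' : ℝ → ℝ} {t : ℝ} (hd : HasDerivAt e (e' t) t)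
    (hd' : HasDerivAt e' (e'' t) t) : HasDerivAt (cutoffBandPathFnD1 e₀ ν e e') (cutoffBandPathFnD2 e₀ ν e e' e'' t) t :=
  ((hasDerivAt_cutoffFreqFnD1 he ν (e t)).comp t hd).mul hd'

/-- `|R| ≤ 1`. [cite: BenfattoGiulianiMastropietro2006, §2.2 (2.9)] -/
theorem abs_cutoffBandPathFn_le_one (e₀ ν : ℝ) (e : ℝ → ℝ) (t : ℝ) : |cutoffBandPathFn e₀ ν e t| ≤ 1 :=
  abs_cutoffFreqFn_le_one e₀ ν (e t)

/-- **`|R′| ≤ (8/(3e₀))·D`** when `|e′(t)| ≤ D`. [cite: BenfattoGiulianiMastropietro2006, §2.5 Lemma 2.2] -/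
theorem abs_cutoffBandPathFnD1_le (he : 0 < e₀) (ν : ℝ) {e e' : ℝ → ℝ} {t D : ℝ} (h1 : |e' t| ≤ D) :
    |cutoffBandPathFnD1 e₀ ν e e' t| ≤ 8 / (3 * e₀) * D := by
  rw [cutoffBandPathFnD1, abs_mul]
  exact mul_le_mul (abs_cutoffFreqFnD1_le he ν (e t)) h1 (abs_nonneg _) (by positivity)

/-- **`|R″| ≤ (448/(9e₀²))·D² + (8/(3e₀))·D`** when `|e′(t)|, |e″(t)| ≤ D`. [cite: BenfattoGiulianiMastropietro2006, §2.5 Lemma 2.2] -/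
theorem abs_cutoffBandPathFnD2_le (he : 0 < e₀) (ν : ℝ) {e e' e'' : ℝ → ℝ} {t D : ℝ} (h1 : |e' t| ≤ D) (h2 : |e'' t| ≤ D) :
    |cutoffBandPathFnD2 e₀ ν e e' e'' t| ≤ 448 / (9 * e₀ ^ 2) * D ^ 2 + 8 / (3 * e₀) * D := by
  have hD : 0 ≤ D := (abs_nonneg _).trans h1
  rw [cutoffBandPathFnD2]
  refine (abs_add_le _ _).trans (add_le_add ?_ ?_)
  · rw [abs_mul, abs_mul, mul_assoc]
    refine mul_le_mul (abs_cutoffFreqFnD2_le he ν (e t)) ?_ (by positivity) (by positivity)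
    rw [pow_two]
    exact mul_le_mul h1 h1 (abs_nonneg _) hD
  · rw [abs_mul]
    exact mul_le_mul (abs_cutoffFreqFnD1_le he ν (e t)) h2 (abs_nonneg _) (by positivity)

/-- **The radial factor along a lattice line of an admissible frame band**: for a path with `HasDerivAt` first and second derivatives bounded by
`D` everywhere (the content of `UVLineBound`), `R` is `C²` with `|R′| ≤ (8/(3e₀))D`, `|R″| ≤ (448/(9e₀²))D² + (8/(3e₀))D` at every `t`.
[cite: FeldmanSalmhoferTrubowitz1996, §1 Discussion (E = e + K)] -/
theorem cutoffBandPathFn_bounds (he : 0 < e₀) (ν : ℝ) {e e' e'' : ℝ → ℝ} {D : ℝ} (hd : ∀ t, HasDerivAt e (e' t) t)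
    (hd' : ∀ t, HasDerivAt e' (e'' t) t) (hb : ∀ t, |e' t| ≤ D ∧ |e'' t| ≤ D) (t : ℝ) :
    HasDerivAt (cutoffBandPathFn e₀ ν e) (cutoffBandPathFnD1 e₀ ν e e' t) t ∧
      HasDerivAt (cutoffBandPathFnD1 e₀ ν e e') (cutoffBandPathFnD2 e₀ ν e e' e'' t) t ∧
        |cutoffBandPathFnD1 e₀ ν e e' t| ≤ 8 / (3 * e₀) * D ∧
          |cutoffBandPathFnD2 e₀ ν e e' e'' t| ≤ 448 / (9 * e₀ ^ 2) * D ^ 2 + 8 / (3 * e₀) * D :=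
  ⟨hasDerivAt_cutoffBandPathFn he ν (hd t), hasDerivAt_cutoffBandPathFnD1 he ν (hd t) (hd' t), abs_cutoffBandPathFnD1_le he ν (hb t).1,
    abs_cutoffBandPathFnD2_le he ν (hb t).1 (hb t).2⟩

end Radial

end Literature.MathematicalPhysics.QuantumLattice

end
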